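import Mathlib.Geometry.Manifold.Instances.Sphere
import Literature.Geometry.Manifold.LocalExtrMFDeriv
import HarnessLib

/-!
# The Morse–Bott function of brick F3: a toolkit of manifold calculus (layer `f3fa_toolkit`)

Auxiliary file of stub `helper_f3_functionAlpha` (layer FA of the construction brick F3), line
`Sketch`, crux `SblfDescent.RungOne`.

(Crux item stmt-SmoothPoincare4-18531; skeleton `Cruxes/RungOne/Lines/Sketch.lean`.)

The function and the angular map of brick F3 are `F x = 𝔉 (f x, a x)`, `α x = 𝔄 (f x, a x)` for
explicit smooth `𝔉`, `𝔄` on `ℝ³ × ℝ²` and the sphere-valued maps `f : X → S²`, `a : X → S¹`.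
All their differentials are computed from four generic facts collected here:

* **sphere-valued maps seen in the ambient space**: for `g : M → Sⁿ ⊆ E`, the differential of
  `x ↦ (g x : E)` is `d(incl) ∘ dg`; it kills exactly the vectors killed by `dg` (Mathlib's
  `mfderiv_coe_sphere_injective`), takes values orthogonal to `g x`
  (`range_mfderiv_coe_sphere`), and takes every such value if `dg` is onto;
* **chain rule through a pair**: if `F = Φ (g₁, g₂)` near `x` with `Φ` differentiable at
  `(g₁ x, g₂ x)` then `dF_x w = DΦ (dg₁ w, dg₂ w)`;
* **derivative along a curve**: `d/dt G (γ t) = dG (γ̇)`;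
* **Fermat**: if `F - G` has a local minimum at `x` then `dF_x = dG_x`
  (`IsLocalMin.mfderiv_eq_zero` of `LocalExtrMFDeriv.lean`).

## References

* J. Milnor, *Morse theory*, Ann. of Math. Studies 51 (1963), §2. [Milnor1963]
* J. M. Lee, *Introduction to Smooth Manifolds*, 2nd ed. (2013), Prop. 3.23, Cor. 3.25.
  [LeeSmoothManifolds2013]
-/

set_option linter.dupNamespace false

noncomputable section

open scoped Manifold ContDiff Topology RealInnerProductSpace
open Set Function Filter Module

namespace Summit.SmoothPoincare4.SmoothPoincare4.Cruxes.RungOne.Sketch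

namespace F3fa

-- BEGIN BODY
section Toolkit

variable {EM : Type*} [NormedAddCommGroup EM] [NormedSpace ℝ EM] {HM : Type*} [TopologicalSpace HM]
  {I : ModelWithCorners ℝ EM HM} {M : Type*} [TopologicalSpace M] [ChartedSpace HM M]

/-! ### Sphere-valued maps seen in the ambient space -/

section Sphere

variable {E : Type*} [NormedAddCommGroup E] [InnerProductSpace ℝ E] {n : ℕ} [Fact (finrank ℝ E = n + 1)]
  {g : M → Metric.sphere (0 : E) 1} {x : M}

/-- The ambient map `x ↦ (g x : E)` of a differentiable sphere-valued map is differentiable.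
[folklore] -/
theorem mdifferentiableAt_coe_comp (hg : MDifferentiableAt I (𝓡 n) g x) :
    MDifferentiableAt I 𝓘(ℝ, E) (fun x => (g x : E)) x :=
  ((contMDiff_coe_sphere (g x)).mdifferentiableAt one_ne_zero).comp x hg

/-- **Chain rule for the ambient map**: `d(incl ∘ g) = d(incl) ∘ dg`. [folklore] -/
theorem mfderiv_coe_comp_apply (hg : MDifferentiableAt I (𝓡 n) g x) (w : TangentSpace I x) :
    mfderiv I 𝓘(ℝ, E) (fun x => (g x : E)) x w =
      mfderiv (𝓡 n) 𝓘(ℝ, E) ((↑) : Metric.sphere (0 : E) 1 → E) (g x) (mfderiv I (𝓡 n) g x w) := by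
  have h := mfderiv_comp x ((contMDiff_coe_sphere (g x)).mdifferentiableAt one_ne_zero) hg
  exact congrArg (fun L : TangentSpace I x →L[ℝ] E => L w) h

/-- A vector killed by `dg` is killed by `d(incl ∘ g)`. [folklore] -/
theorem mfderiv_coe_comp_eq_zero (hg : MDifferentiableAt I (𝓡 n) g x) {w : TangentSpace I x}
    (hw : mfderiv I (𝓡 n) g x w = 0) : mfderiv I 𝓘(ℝ, E) (fun x => (g x : E)) x w = 0 := by
  rw [mfderiv_coe_comp_apply hg, hw, map_zero]

/-- **A vector not killed by `dg` is not killed by `d(incl ∘ g)`** (the inclusion of the sphere is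
an immersion, Mathlib's `mfderiv_coe_sphere_injective`). [folklore] -/
theorem mfderiv_coe_comp_ne_zero (hg : MDifferentiableAt I (𝓡 n) g x) {w : TangentSpace I x}
    (hw : mfderiv I (𝓡 n) g x w ≠ 0) : mfderiv I 𝓘(ℝ, E) (fun x => (g x : E)) x w ≠ 0 := by
  rw [mfderiv_coe_comp_apply hg]
  intro h0
  exact hw ((injective_iff_map_eq_zero _).1 (mfderiv_coe_sphere_injective (n := n) (g x)) _ h0)

/-- **The ambient differential is tangent to the sphere**: `⟪g x, d(incl ∘ g) w⟫ = 0`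
(Mathlib's `range_mfderiv_coe_sphere`). [folklore] -/
theorem inner_mfderiv_coe_comp (hg : MDifferentiableAt I (𝓡 n) g x) (w : TangentSpace I x) :
    ⟪(g x : E), mfderiv I 𝓘(ℝ, E) (fun x => (g x : E)) x w⟫ = 0 := by
  rw [mfderiv_coe_comp_apply hg]
  have hmem : mfderiv (𝓡 n) 𝓘(ℝ, E) ((↑) : Metric.sphere (0 : E) 1 → E) (g x) (mfderiv I (𝓡 n) g x w) ∈
      (ℝ ∙ ((g x : Metric.sphere (0 : E) 1) : E))ᗮ := by
    rw [← range_mfderiv_coe_sphere (n := n) (g x)]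
    exact ⟨_, rfl⟩
  exact (Submodule.mem_orthogonal_singleton_iff_inner_right.1 hmem)

/-- **A submersive sphere-valued map reaches every tangent vector**: if `dg_x` is onto then every
`ζ ⊥ g x` is `d(incl ∘ g) w` for some `w`. [folklore] -/
theorem exists_mfderiv_coe_comp_eq (hg : MDifferentiableAt I (𝓡 n) g x) (hs : Surjective (mfderiv I (𝓡 n) g x))
    {ζ : E} (hζ : ⟪(g x : E), ζ⟫ = 0) : ∃ w : TangentSpace I x, mfderiv I 𝓘(ℝ, E) (fun x => (g x : E)) x w = ζ := by
  have hmem : ζ ∈ (ℝ ∙ ((g x : Metric.sphere (0 : E) 1) : E))ᗮ :=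
    Submodule.mem_orthogonal_singleton_iff_inner_right.2 hζ
  rw [← range_mfderiv_coe_sphere (n := n) (g x)] at hmem
  obtain ⟨ξ, hξ⟩ := hmem
  obtain ⟨w, rfl⟩ := hs ξ
  exact ⟨w, by rw [mfderiv_coe_comp_apply hg]; exact hξ⟩

end Sphere

/-! ### Chain rule through a pair of ambient maps -/

section Pair

variable {E₁ : Type*} [NormedAddCommGroup E₁] [NormedSpace ℝ E₁] {E₂ : Type*} [NormedAddCommGroup E₂] [NormedSpace ℝ E₂]
  {F' : Type*} [NormedAddCommGroup F'] [NormedSpace ℝ F']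

/-- **Chain rule through a pair**: if `F = Φ (g₁, g₂)` near `x`, `Φ` has derivative `L` at
`(g₁ x, g₂ x)` and `g₁`, `g₂` have differentials `d₁`, `d₂` at `x`, then `F` has differential
`L ∘ (d₁, d₂)` at `x`. [folklore] -/
theorem hasMFDerivAt_of_comp_pair {F : M → F'} {g₁ : M → E₁} {g₂ : M → E₂} {Φ : E₁ × E₂ → F'} {x : M}
    {L : E₁ × E₂ →L[ℝ] F'} {d₁ : TangentSpace I x →L[ℝ] E₁} {d₂ : TangentSpace I x →L[ℝ] E₂}
    (hF : F =ᶠ[𝓝 x] fun x' => Φ (g₁ x', g₂ x')) (hΦ : HasFDerivAt Φ L (g₁ x, g₂ x))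
    (h₁ : HasMFDerivAt I 𝓘(ℝ, E₁) g₁ x d₁) (h₂ : HasMFDerivAt I 𝓘(ℝ, E₂) g₂ x d₂) :
    HasMFDerivAt I 𝓘(ℝ, F') F x (L.comp (d₁.prod d₂)) := by
  -- the pair as a sum of two linear images, to stay in the model `𝓘(ℝ, E₁ × E₂)`
  have hG : HasMFDerivAt I 𝓘(ℝ, E₁ × E₂) (fun x' => (g₁ x', g₂ x')) x (d₁.prod d₂) := by
    have e1 : HasMFDerivAt I 𝓘(ℝ, E₁ × E₂) (fun x' => ContinuousLinearMap.inl ℝ E₁ E₂ (g₁ x')) x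
        ((ContinuousLinearMap.inl ℝ E₁ E₂).comp d₁) :=
      (hasMFDerivAt_iff_hasFDerivAt.2 (ContinuousLinearMap.inl ℝ E₁ E₂).hasFDerivAt).comp x h₁
    have e2 : HasMFDerivAt I 𝓘(ℝ, E₁ × E₂) (fun x' => ContinuousLinearMap.inr ℝ E₁ E₂ (g₂ x')) x
        ((ContinuousLinearMap.inr ℝ E₁ E₂).comp d₂) :=
      (hasMFDerivAt_iff_hasFDerivAt.2 (ContinuousLinearMap.inr ℝ E₁ E₂).hasFDerivAt).comp x h₂
    have e := e1.add e2
    have heq : (fun x' => (g₁ x', g₂ x')) = fun x' =>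
        ContinuousLinearMap.inl ℝ E₁ E₂ (g₁ x') + ContinuousLinearMap.inr ℝ E₁ E₂ (g₂ x') := by
      funext x'; simp
    have hL : d₁.prod d₂ = (ContinuousLinearMap.inl ℝ E₁ E₂).comp d₁ + (ContinuousLinearMap.inr ℝ E₁ E₂).comp d₂ := by
      ext w <;> simp
    rw [heq, hL]
    exact e
  have hc := (hasMFDerivAt_iff_hasFDerivAt.2 hΦ).comp x hG
  exact hc.congr_of_eventuallyEq hF

/-- The value of the differential in the situation of `hasMFDerivAt_of_comp_pair`. [folklore] -/
theorem mfderiv_of_comp_pair_apply {F : M → F'} {g₁ : M → E₁} {g₂ : M → E₂} {Φ : E₁ × E₂ → F'} {x : M}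
    {L : E₁ × E₂ →L[ℝ] F'} (hF : F =ᶠ[𝓝 x] fun x' => Φ (g₁ x', g₂ x')) (hΦ : HasFDerivAt Φ L (g₁ x, g₂ x))
    (h₁ : MDifferentiableAt I 𝓘(ℝ, E₁) g₁ x) (h₂ : MDifferentiableAt I 𝓘(ℝ, E₂) g₂ x) (w : TangentSpace I x) :
    mfderiv I 𝓘(ℝ, F') F x w = L (mfderiv I 𝓘(ℝ, E₁) g₁ x w, mfderiv I 𝓘(ℝ, E₂) g₂ x w) := by
  rw [(hasMFDerivAt_of_comp_pair hF hΦ h₁.hasMFDerivAt h₂.hasMFDerivAt).mfderiv]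
  rfl

/-- In the situation of `hasMFDerivAt_of_comp_pair`, `F` is differentiable at `x`. [folklore] -/
theorem mdifferentiableAt_of_comp_pair {F : M → F'} {g₁ : M → E₁} {g₂ : M → E₂} {Φ : E₁ × E₂ → F'} {x : M}
    {L : E₁ × E₂ →L[ℝ] F'} (hF : F =ᶠ[𝓝 x] fun x' => Φ (g₁ x', g₂ x')) (hΦ : HasFDerivAt Φ L (g₁ x, g₂ x))
    (h₁ : MDifferentiableAt I 𝓘(ℝ, E₁) g₁ x) (h₂ : MDifferentiableAt I 𝓘(ℝ, E₂) g₂ x) :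
    MDifferentiableAt I 𝓘(ℝ, F') F x :=
  (hasMFDerivAt_of_comp_pair hF hΦ h₁.hasMFDerivAt h₂.hasMFDerivAt).mdifferentiableAt

end Pair

/-! ### Derivative along a curve -/

section Curve

variable {F' : Type*} [NormedAddCommGroup F'] [NormedSpace ℝ F']

/-- **Derivative along a curve**: for a curve `γ : ℝ → M` differentiable at `t` and `G : M → F'`
differentiable at `γ t`, the real function `G ∘ γ` has derivative `dG (γ̇)` at `t`,
`γ̇ = dγ_t 1`. [folklore] -/
theorem hasDerivAt_comp_curve {γ : ℝ → M} {G : M → F'} {t : ℝ} (hG : MDifferentiableAt I 𝓘(ℝ, F') G (γ t))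
    (hγ : MDifferentiableAt 𝓘(ℝ, ℝ) I γ t) :
    HasDerivAt (fun s => G (γ s)) ((mfderiv I 𝓘(ℝ, F') G (γ t) (mfderiv 𝓘(ℝ, ℝ) I γ t (1 : ℝ)) : F')) t := by
  have h := hG.hasMFDerivAt.comp t hγ.hasMFDerivAt
  have h' := hasMFDerivAt_iff_hasFDerivAt.1 h
  set L : ℝ →L[ℝ] F' := (mfderiv I 𝓘(ℝ, F') G (γ t)).comp (mfderiv 𝓘(ℝ, ℝ) I γ t) with hL
  have h'' : HasFDerivAt (G ∘ γ) L t := h'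
  exact h''.hasDerivAt

/-- **A critical point kills every curve through it**: if `dG_{γ t} = 0` then
`(G ∘ γ)' (t) = 0`. [folklore] -/
theorem deriv_comp_curve_eq_zero {γ : ℝ → M} {G : M → F'} {t : ℝ} (hG : MDifferentiableAt I 𝓘(ℝ, F') G (γ t))
    (hγ : MDifferentiableAt 𝓘(ℝ, ℝ) I γ t) (h0 : mfderiv I 𝓘(ℝ, F') G (γ t) = 0) :
    deriv (fun s => G (γ s)) t = 0 := by
  rw [(hasDerivAt_comp_curve hG hγ).deriv, h0]
  rfl

end Curve

/-! ### Fermat -/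

section Fermat

variable [I.Boundaryless]

/-- **Fermat, comparison form**: if `F - G` has a local minimum at `x` and both are differentiable
there, then `dF_x = dG_x`. [folklore] -/
theorem mfderiv_eq_of_isLocalMin_sub {F G : M → ℝ} {x : M} (hF : MDifferentiableAt I 𝓘(ℝ, ℝ) F x)
    (hG : MDifferentiableAt I 𝓘(ℝ, ℝ) G x) (h : IsLocalMin (fun y => F y - G y) x) :
    mfderiv I 𝓘(ℝ, ℝ) F x = mfderiv I 𝓘(ℝ, ℝ) G x := by
  have h0 : mfderiv I 𝓘(ℝ, ℝ) (fun y => F y - G y) x = 0 := h.mfderiv_eq_zero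
  have hs := mfderiv_sub hF hG
  rw [show (F - G) = fun y => F y - G y from rfl] at hs
  rw [hs] at h0
  exact sub_eq_zero.1 h0

/-- **Fermat, comparison form**: if `F - G` has a local maximum at `x` and both are differentiable
there, then `dF_x = dG_x`. [folklore] -/
theorem mfderiv_eq_of_isLocalMax_sub {F G : M → ℝ} {x : M} (hF : MDifferentiableAt I 𝓘(ℝ, ℝ) F x)
    (hG : MDifferentiableAt I 𝓘(ℝ, ℝ) G x) (h : IsLocalMax (fun y => F y - G y) x) :
    mfderiv I 𝓘(ℝ, ℝ) F x = mfderiv I 𝓘(ℝ, ℝ) G x := by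
  have h0 : mfderiv I 𝓘(ℝ, ℝ) (fun y => F y - G y) x = 0 := h.mfderiv_eq_zero
  have hs := mfderiv_sub hF hG
  rw [show (F - G) = fun y => F y - G y from rfl] at hs
  rw [hs] at h0
  exact sub_eq_zero.1 h0

end Fermat

/-! ### Non-critical points -/

/-- A map with a vector of non-zero derivative is not critical, and conversely a non-zero
differential has such a vector. [folklore] -/
theorem exists_mfderiv_ne_zero {F' : Type*} [NormedAddCommGroup F'] [NormedSpace ℝ F'] {F : M → F'} {x : M}
    (h : mfderiv I 𝓘(ℝ, F') F x ≠ 0) : ∃ w : TangentSpace I x, mfderiv I 𝓘(ℝ, F') F x w ≠ 0 := by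
  by_contra hcon
  apply h
  ext w
  by_contra hw
  exact hcon ⟨w, hw⟩

end Toolkit

/-- **Layer `f3fa_toolkit` of stub `helper_f3_functionAlpha`: manifold calculus of functions of
sphere-valued maps.**  For a differentiable sphere-valued map `g : M → Sⁿ ⊆ E` the ambient
differential `d(incl ∘ g)` is tangent to the sphere (`⟪g x, d(incl ∘ g) w⟫ = 0`), vanishes
exactly on the vectors killed by `dg`, and reaches every vector orthogonal to `g x` when `dg_x`
is onto; and a function of the form `F = Φ (g₁, g₂)` near `x` has
`dF_x w = DΦ (dg₁ w, dg₂ w)` (chain rule; Lee 2013, Prop. 3.23 and Cor. 3.25, with Mathlib's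
`range_mfderiv_coe_sphere`, `mfderiv_coe_sphere_injective`). [cite: LeeSmoothManifolds2013, Prop. 3.23] -/
theorem helper_f3fa_toolkit : ∀ {EM : Type} [NormedAddCommGroup EM] [NormedSpace ℝ EM] {HM : Type} [TopologicalSpace HM] (I : ModelWithCorners ℝ EM HM) {M : Type} [TopologicalSpace M] [ChartedSpace HM M] {E : Type} [NormedAddCommGroup E] [InnerProductSpace ℝ E] {n : ℕ} [Fact (Module.finrank ℝ E = n + 1)] (g : M → Metric.sphere (0 : E) 1) (x : M), MDifferentiableAt I (𝓡 n) g x → (∀ w : TangentSpace I x, ⟪(g x : E), mfderiv I 𝓘(ℝ, E) (fun x => (g x : E)) x w⟫ = 0 ∧ (mfderiv I 𝓘(ℝ, E) (fun x => (g x : E)) x w = 0 ↔ mfderiv I (𝓡 n) g x w = 0)) ∧ (Function.Surjective (mfderiv I (𝓡 n) g x) → ∀ ζ : E, ⟪(g x : E), ζ⟫ = 0 → ∃ w : TangentSpace I x, mfderiv I 𝓘(ℝ, E) (fun x => (g x : E)) x w = ζ) := by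
  intro EM _ _ HM _ I M _ _ E _ _ n _ g x hg
  refine ⟨fun w => ⟨inner_mfderiv_coe_comp hg w, ⟨fun h => ?_, mfderiv_coe_comp_eq_zero hg⟩⟩,
    fun hs ζ hζ => exists_mfderiv_coe_comp_eq hg hs hζ⟩
  by_contra hne
  exact mfderiv_coe_comp_ne_zero hg hne h

-- END BODY
end F3fa

end Summit.SmoothPoincare4.SmoothPoincare4.Cruxes.RungOne.Sketch

end
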